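import Summits.QuantumFields.BalabanUV.Beta.BorderedHessianRooted
import Literature.MathematicalPhysics.QuantumFieldTheory.Balaban1983to89.Beta.BalabanStepJetsSucc

/-!
# THE CANDIDATE STEP-`j` EFFECTIVE BORDERED HESSIAN `bhKStepAt ρ Lc j` — the binder `𝕄_j` of the coarse wiring as a DATA DEFINITION:
# `[[M^{2(d+2)}·E2 d Lc j, M^{d+2}·(border of bhKAt ρ Lc)],[M^{d+2}·(border), 0]]`, `M = Lc^j`; its BORDERED SHAPE and SPREAD
# (β sub-cell, row BETA-an2, gen 14; BINDER-OWNERS row D1 item (l); an4-g33 NOTE-D1-Mj-supplier §2; AN2 §40.2 (e), §40.7 (c)–(d))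

HONEST FRAMING (cell charter, verbatim): «discharging BetaPertH makes Balaban's UV stability UNCONDITIONAL — a real
constructive-QFT result; it is NOT the continuum limit and NOT the Clay problem.»  DERIVED cell leaf (pub-balaban β sub-cell, lane
an2 gen 14); no statement of Bałaban's papers is typed here, no `[cite:]` tag, no `Prop` fact; it instantiates no binder of the
β-function wall by itself.  NOTHING is claimed about rules 3–4 of `RelInv` for this kernel at `j ≥ 1` (the OPEN binder; EXACT in an2's
finite toy at `j = 1` in five geometries, kit j082528 — evidence, not a theorem).  NOT `BetaPertH`; NOT continuum; NOT Clay.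

## What is here ([folklore] data definition + bookkeeping)

* `bhKStepAt d ρ Lc : ℕ → MKer (d+1) (Fib d)`: at `0` the rooted bordered Hessian `bhKAt d ρ Lc` (`bhKStepAt_zero`, `rfl`); at `j+1`, with
  `M = Lc^{j+1}`: field block `wVH d Lc (j+1) · E2 d Lc (j+1)` (`wVH = M^{2(d+2)}`; `E2 = mmRead M (KInv M)` = the multiplier block of the
  level-`M` packed resolvent READ on the step lattice — an4-g33's `T_j`, an2's reading of Bałaban's `Δ_j`), field–multiplier /
  multiplier–field blocks `M^{d+2} ·` those of `bhKAt d ρ Lc` (one unit `M^{d+2}` per field slot, `InterLevelTransport.liftW` bookkeeping),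
  multiplier block `0` (`bhKStepAt_succ_inl_inl / _inl_inr / _inr_inl / _inr_inr`);
* BORDERED SHAPE for the reduced wiring (`SpineRootedBmNReduced`: hypotheses `hfm`/`hmf`/`hmm` with `s (j+1) = M^{d+2}`):
  `bhKStepAt_succ_fm / _mf / _mm`, `stepScale_ne_zero`;
* SPREAD: `decays_bhKStepAt_succ`, **`spr_bhKStepAt`** (every `j`, in-block root) — the socket hM.
All declarations `[folklore]`; axioms standard.  Provenance: b2b-balaban β sub-cell, unit beta-an2 gen 14, 2026-08-20 (v1); no existing file touched.
-/

open Finset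
open scoped BigOperators
open Literature.MathematicalPhysics.QuantumFieldTheory
open Literature.MathematicalPhysics.QuantumFieldTheory.Balaban1983to89
open Literature.MathematicalPhysics.QuantumFieldTheory.Balaban1983to89.Beta
open B12Sec2to5 (l1 l1_nonneg)
open ExpKernelCalculus (MKer Decays)
open AffineAveraging (box toSite)
open OneStepResolventKernel (Fib KInv decays_mono)
open BalabanStepJetsSucc (E2 decays_E2 wVH)
open Summit.QuantumFields.BalabanUV.Beta.TameKernelCalculus
open Summit.QuantumFields.BalabanUV.Beta.AxialDressingRooted (one_le_of_neZero)

namespace Summit.QuantumFields.BalabanUV.Beta.BorderedHessian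

noncomputable section

variable (d : ℕ) (ρ : Fin (d + 1) → ℤ) (Lc : ℕ) [NeZero Lc]

/-- [folklore] The border scale at step `j`: `M^{d+2}`, `M = Lc^j`. -/
def stepScale (j : ℕ) : ℝ := ((Lc : ℝ) ^ j) ^ (d + 2)

/-- [folklore] **THE CANDIDATE STEP-`j` EFFECTIVE BORDERED HESSIAN** (see the module docstring): `bhKAt` at `j = 0`; at `j + 1` the
field block `wVH (j+1) · E2 (j+1)`, the border `M^{d+2} ·` that of `bhKAt`, the multiplier block `0`. -/
def bhKStepAt : ℕ → MKer (d + 1) (Fib d)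
  | 0 => bhKAt d ρ Lc
  | j + 1 => fun x y a b =>
      match a, b with
      | Sum.inl κ, Sum.inl l => wVH d Lc (j + 1) * E2 d Lc (j + 1) x y (Sum.inl κ) (Sum.inl l)
      | Sum.inl κ, Sum.inr l => stepScale d Lc (j + 1) * bhKAt d ρ Lc x y (Sum.inl κ) (Sum.inr l)
      | Sum.inr κ, Sum.inl l => stepScale d Lc (j + 1) * bhKAt d ρ Lc x y (Sum.inr κ) (Sum.inl l)
      | Sum.inr _, Sum.inr _ => 0

variable {d ρ Lc}

/-- [folklore] `stepScale d Lc j ≠ 0`. -/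
theorem stepScale_ne_zero (j : ℕ) : stepScale d Lc j ≠ 0 := by
  unfold stepScale
  exact pow_ne_zero _ (pow_ne_zero _ (by exact_mod_cast NeZero.ne Lc))

/-- [folklore] `0 < stepScale d Lc j`. -/
theorem stepScale_pos (j : ℕ) : 0 < stepScale d Lc j := by
  unfold stepScale
  have : (0 : ℝ) < Lc := by exact_mod_cast Nat.pos_of_ne_zero (NeZero.ne Lc)
  positivity

/-- [folklore] At `j = 0` the candidate is the rooted bordered Hessian. -/
@[simp] theorem bhKStepAt_zero : bhKStepAt d ρ Lc 0 = bhKAt d ρ Lc := rfl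

/-- [folklore] Field–field entry at `j + 1`. -/
theorem bhKStepAt_succ_inl_inl (j : ℕ) (x y : Fin (d + 1) → ℤ) (κ l : Fin (d + 1)) :
    bhKStepAt d ρ Lc (j + 1) x y (Sum.inl κ) (Sum.inl l) = wVH d Lc (j + 1) * E2 d Lc (j + 1) x y (Sum.inl κ) (Sum.inl l) := rfl

/-- [folklore] Field–multiplier entry at `j + 1` (shape hypothesis `hfm` of the reduced wiring, `s = stepScale`). -/
theorem bhKStepAt_succ_fm (j : ℕ) (x y : Fin (d + 1) → ℤ) (κ l : Fin (d + 1)) :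
    bhKStepAt d ρ Lc (j + 1) x y (Sum.inl κ) (Sum.inr l) = stepScale d Lc (j + 1) * bhKAt d ρ Lc x y (Sum.inl κ) (Sum.inr l) := rfl

/-- [folklore] Multiplier–field entry at `j + 1` (shape hypothesis `hmf`). -/
theorem bhKStepAt_succ_mf (j : ℕ) (x y : Fin (d + 1) → ℤ) (κ l : Fin (d + 1)) :
    bhKStepAt d ρ Lc (j + 1) x y (Sum.inr κ) (Sum.inl l) = stepScale d Lc (j + 1) * bhKAt d ρ Lc x y (Sum.inr κ) (Sum.inl l) := rfl

/-- [folklore] Multiplier–multiplier entry at `j + 1` vanishes (shape hypothesis `hmm`). -/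
theorem bhKStepAt_succ_mm (j : ℕ) (x y : Fin (d + 1) → ℤ) (κ l : Fin (d + 1)) :
    bhKStepAt d ρ Lc (j + 1) x y (Sum.inr κ) (Sum.inr l) = 0 := rfl

/-- [folklore] **THE CANDIDATE DECAYS** at `j + 1` (in-block root): rate that of `E2 d Lc (j+1)`, constant
`wVH·C_E + stepScale·cBHA·e^{δ(d+1)2Lc}`. -/
theorem decays_bhKStepAt_succ {r : Fin (d + 1) → ℕ} (hr : r ∈ box (d + 1) Lc) (j : ℕ) :
    ∃ δ C : ℝ, 0 < δ ∧ 0 ≤ C ∧ Decays (bhKStepAt d (toSite r) Lc (j + 1)) C δ := by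
  obtain ⟨δ, CE, hδ, hCE, hE⟩ := decays_E2 (d := d) (Lc := Lc) (j + 1)
  have hB := decays_bhKAt (d := d) (one_le_of_neZero Lc) hr hδ.le
  set CB : ℝ := cBHA d Lc * Real.exp (δ * (((d : ℝ) + 1) * (2 * Lc))) with hCB
  have hCB0 : 0 ≤ CB := mul_nonneg (cBHA_nonneg d Lc) (Real.exp_pos _).le
  have hw : 0 ≤ wVH d Lc (j + 1) := by unfold BalabanStepJetsSucc.wVH; positivity
  have hs : 0 ≤ stepScale d Lc (j + 1) := (stepScale_pos (j + 1)).le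
  refine ⟨δ, wVH d Lc (j + 1) * CE + stepScale d Lc (j + 1) * CB, hδ, by positivity, fun x y a b => ?_⟩
  have hexp : 0 ≤ Real.exp (-δ * l1 (x - y)) := (Real.exp_pos _).le
  have h1 : wVH d Lc (j + 1) * |E2 d Lc (j + 1) x y a b| ≤ wVH d Lc (j + 1) * (CE * Real.exp (-δ * l1 (x - y))) :=
    mul_le_mul_of_nonneg_left (hE x y a b) hw
  have h2 : stepScale d Lc (j + 1) * |bhKAt d (toSite r) Lc x y a b| ≤ stepScale d Lc (j + 1) * (CB * Real.exp (-δ * l1 (x - y))) :=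
    mul_le_mul_of_nonneg_left (hB x y a b) hs
  have hA : 0 ≤ wVH d Lc (j + 1) * (CE * Real.exp (-δ * l1 (x - y))) := by positivity
  have hB' : 0 ≤ stepScale d Lc (j + 1) * (CB * Real.exp (-δ * l1 (x - y))) := by positivity
  rcases a with κ | κ <;> rcases b with l | l
  · rw [bhKStepAt_succ_inl_inl, abs_mul, abs_of_nonneg hw]
    calc wVH d Lc (j + 1) * |E2 d Lc (j + 1) x y (Sum.inl κ) (Sum.inl l)|
        ≤ wVH d Lc (j + 1) * (CE * Real.exp (-δ * l1 (x - y))) := h1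
      _ ≤ wVH d Lc (j + 1) * (CE * Real.exp (-δ * l1 (x - y))) + stepScale d Lc (j + 1) * (CB * Real.exp (-δ * l1 (x - y))) :=
          le_add_of_nonneg_right hB'
      _ = (wVH d Lc (j + 1) * CE + stepScale d Lc (j + 1) * CB) * Real.exp (-δ * l1 (x - y)) := by ring
  · rw [bhKStepAt_succ_fm, abs_mul, abs_of_nonneg hs]
    calc stepScale d Lc (j + 1) * |bhKAt d (toSite r) Lc x y (Sum.inl κ) (Sum.inr l)|
        ≤ stepScale d Lc (j + 1) * (CB * Real.exp (-δ * l1 (x - y))) := h2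
      _ ≤ wVH d Lc (j + 1) * (CE * Real.exp (-δ * l1 (x - y))) + stepScale d Lc (j + 1) * (CB * Real.exp (-δ * l1 (x - y))) :=
          le_add_of_nonneg_left hA
      _ = (wVH d Lc (j + 1) * CE + stepScale d Lc (j + 1) * CB) * Real.exp (-δ * l1 (x - y)) := by ring
  · rw [bhKStepAt_succ_mf, abs_mul, abs_of_nonneg hs]
    calc stepScale d Lc (j + 1) * |bhKAt d (toSite r) Lc x y (Sum.inr κ) (Sum.inl l)|
        ≤ stepScale d Lc (j + 1) * (CB * Real.exp (-δ * l1 (x - y))) := h2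
      _ ≤ wVH d Lc (j + 1) * (CE * Real.exp (-δ * l1 (x - y))) + stepScale d Lc (j + 1) * (CB * Real.exp (-δ * l1 (x - y))) :=
          le_add_of_nonneg_left hA
      _ = (wVH d Lc (j + 1) * CE + stepScale d Lc (j + 1) * CB) * Real.exp (-δ * l1 (x - y)) := by ring
  · rw [bhKStepAt_succ_mm, abs_zero]
    positivity

/-- [folklore] **THE CANDIDATE IS SPREAD at every level** (in-block root) — the socket hM of the coarse wiring for `𝕄 := bhKStepAt`. -/
theorem spr_bhKStepAt {r : Fin (d + 1) → ℕ} (hr : r ∈ box (d + 1) Lc) : ∀ j : ℕ, Spr (bhKStepAt d (toSite r) Lc j)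
  | 0 => by rw [bhKStepAt_zero]; exact spr_bhKAt (one_le_of_neZero Lc) hr
  | j + 1 => by
    obtain ⟨δ, C, hδ, -, h⟩ := decays_bhKStepAt_succ (d := d) (Lc := Lc) hr j
    exact ⟨C, δ, hδ, h⟩

end

end Summit.QuantumFields.BalabanUV.Beta.BorderedHessian
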